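import Summits.AnomalousDissipation.AnomalousDissipation.Theorems.SolenoidalFractalHomogenisationLagrangianStepSidebandDefs
import Literature.Analysis.FluidPDE.PassiveVectorTensorFourier
import HarnessLib

/-!
# K1L_D `LagrangianRenormalisationStepDesign` (stmt-AnomalousDissipation-27980), `stub_cellLawV0_IS` V0 — the SYMBOL of the exact effective map:
# `4π²·(1/ν)·T_{psiStarᵀ}(k) z = Σ_{j j'} (êⱼ·k)(ê_{j'}·k) · (Re M_{jj'}) z` (helper; `--supports stmt-AnomalousDissipation-27980`)

Summits-side helper file of route `SolenoidalFractalHomogenisation` (prover seat `ad-k1l-cellLawV-w1` g5; definition of record D26-3 = `…SidebandDefs`).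
Everything proved; no definitions, no named facts, no sorry.

* `symb_majorTranspose_psiStar_entry` — for `ν > 0`, every integer wave vector `k` and `i l : Fin 3`:
  `Σ_{a,b} (psiStarᵀ) l a i b · k_a k_b = (ν/(4π²)) · Σ_{j,j'} (êⱼ·k)(ê_{j'}·k) · Re((M_{jj'} e_l)_i)` (the index placement of `psiStar`; a fourfold
  rearrangement);
* **`symbT_majorTranspose_psiStar_apply`** — `(T_{(psiStar W M hM ν S)ᵀ}(k) z)_i = Σ_l [(ν/(4π²)) Σ_{j,j'} (êⱼ·k)(ê_{j'}·k) Re((M_{jj'} e_l)_i)] · z_l`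
  (`Torus.symbT_apply`): the modal generator of the effective tensor `(c/ν)•Ψ` at the slow mode `ℓ` is the period-mean feedback operator
  `Σ_{jj'} (êⱼ·ℓ)(ê_{j'}·ℓ) Re M_{jj'}` — the identity steps T7/T8 of the V0 architecture (and clause (i)) consume;
* `symbT_majorTranspose_psiStar_of_not_pos` — off `ν > 0` the symbol vanishes.
NOT a proof of any registered stub, of the crux, or of anomalous dissipation; rung F-D1.A0 infrastructure.
-/

set_option linter.dupNamespace false

noncomputable section

namespace Summit.AnomalousDissipation.AnomalousDissipation.Theorems.SolenoidalFractalHomogenisation.LagrangianStep.Sideband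

open Set MeasureTheory Complex UnitAddTorus
open scoped InnerProductSpace
open Literature.Analysis Literature.Analysis.FunctionSpaces Literature.Analysis.FunctionSpaces.Torus
open Literature.Analysis.FluidPDE Literature.Analysis.FluidPDE.Torus Literature.Analysis.FluidPDE.LatticeShear

variable {k₀ : ℕ}

/-- Rearrangement of a fourfold finite sum. [folklore] -/
private theorem sum4_comm (F : Fin 3 → Fin 3 → Fin k₀ → Fin k₀ → ℂ) :
    ∑ a, ∑ b, ∑ j, ∑ j', F a b j j' = ∑ j, ∑ j', ∑ a, ∑ b, F a b j j' := by
  calc ∑ a, ∑ b, ∑ j, ∑ j', F a b j j' = ∑ a, ∑ j, ∑ b, ∑ j', F a b j j' :=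
        Finset.sum_congr rfl fun a _ => Finset.sum_comm
    _ = ∑ j, ∑ a, ∑ b, ∑ j', F a b j j' := Finset.sum_comm
    _ = ∑ j, ∑ a, ∑ j', ∑ b, F a b j j' :=
        Finset.sum_congr rfl fun j _ => Finset.sum_congr rfl fun a _ => Finset.sum_comm
    _ = ∑ j, ∑ j', ∑ a, ∑ b, F a b j j' := Finset.sum_congr rfl fun j _ => Finset.sum_comm

/-- **The matrix entries of the symbol of the exact effective map** (`ν > 0`): for every integer wave vector `k` and `i l : Fin 3`,
`Σ_{a,b} (psiStarᵀ) l a i b · k_a k_b = (ν/(4π²)) · Σ_{j,j'} (êⱼ·k)(ê_{j'}·k) · Re((M_{jj'} e_l)_i)`. [cite: MajdaKramer1999, §2.2.1.3 (55)] -/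
theorem symb_majorTranspose_psiStar_entry (W : LatticeWord k₀) (M : ℝ) (hM : 0 < M) {ν : ℝ} (hν : 0 < ν) (S : Torus.Visc4 (Fin 3))
    (k : Fin 3 → ℤ) (i l : Fin 3) :
    ∑ a, ∑ b, ((Torus.majorTranspose (psiStar W M hM ν S) l a i b * (k a : ℝ) * (k b : ℝ) : ℝ) : ℂ) =
      ((ν / (4 * Real.pi ^ 2) : ℝ) : ℂ) * ∑ j : Fin k₀, ∑ j' : Fin k₀,
        ((∑ a, (((W.stretch M hM).stretch (1 / ν) (one_div_pos.mpr hν)).phase j).e a * (k a : ℝ) : ℝ) : ℂ) *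
        ((∑ b, (((W.stretch M hM).stretch (1 / ν) (one_div_pos.mpr hν)).phase j').e b * (k b : ℝ) : ℝ) : ℂ) *
        ((((meanFeedback ((W.stretch M hM).stretch (1 / ν) (one_div_pos.mpr hν)) (ν • S) 1 (R0 ν) j j'
          (EuclideanSpace.single l (1:ℂ))) i).re : ℝ) : ℂ) := by
  -- opaque abbreviations
  obtain ⟨e, he⟩ : ∃ e : Fin k₀ → Fin 3 → ℝ, ∀ j a, (((W.stretch M hM).stretch (1 / ν) (one_div_pos.mpr hν)).phase j).e a = e j a :=
    ⟨_, fun _ _ => rfl⟩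
  obtain ⟨m, hm⟩ : ∃ m : Fin k₀ → Fin k₀ → ℝ, ∀ j j',
      ((meanFeedback ((W.stretch M hM).stretch (1 / ν) (one_div_pos.mpr hν)) (ν • S) 1 (R0 ν) j j' (EuclideanSpace.single l (1:ℂ))) i).re = m j j' :=
    ⟨_, fun _ _ => rfl⟩
  have hΨ : ∀ a b : Fin 3, Torus.majorTranspose (psiStar W M hM ν S) l a i b = ν / (4 * Real.pi ^ 2) * ∑ j : Fin k₀, ∑ j' : Fin k₀,
      e j' b * e j a * m j j' := fun a b => by
    rw [Torus.majorTranspose_apply, psiStar_of_pos W M hM hν S]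
    simp only [he, hm]
  simp only [hΨ, he, hm]
  push_cast
  set C : ℂ := (ν : ℂ) / (4 * (Real.pi : ℂ) ^ 2) with hC
  -- both sides as the same fourfold sum
  have hL : ∑ a, ∑ b, C * (∑ j, ∑ j', (e j' b : ℂ) * (e j a : ℂ) * (m j j' : ℂ)) * (k a : ℂ) * (k b : ℂ) =
      ∑ a, ∑ b, ∑ j, ∑ j', C * (e j' b : ℂ) * (e j a : ℂ) * (m j j' : ℂ) * (k a : ℂ) * (k b : ℂ) := by
    refine Finset.sum_congr rfl fun a _ => Finset.sum_congr rfl fun b _ => ?_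
    rw [Finset.mul_sum, Finset.sum_mul, Finset.sum_mul]
    refine Finset.sum_congr rfl fun j _ => ?_
    rw [Finset.mul_sum, Finset.sum_mul, Finset.sum_mul]
    refine Finset.sum_congr rfl fun j' _ => ?_
    ring
  have hR : C * ∑ j, ∑ j', (∑ a, (e j a : ℂ) * (k a : ℂ)) * (∑ b, (e j' b : ℂ) * (k b : ℂ)) * (m j j' : ℂ) =
      ∑ j, ∑ j', ∑ a, ∑ b, C * (e j' b : ℂ) * (e j a : ℂ) * (m j j' : ℂ) * (k a : ℂ) * (k b : ℂ) := by
    rw [Finset.mul_sum]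
    refine Finset.sum_congr rfl fun j _ => ?_
    rw [Finset.mul_sum]
    refine Finset.sum_congr rfl fun j' _ => ?_
    rw [Finset.sum_mul_sum, Finset.sum_mul, Finset.mul_sum]
    refine Finset.sum_congr rfl fun a _ => ?_
    rw [Finset.sum_mul, Finset.mul_sum]
    refine Finset.sum_congr rfl fun b _ => ?_
    ring
  rw [hL, hR, sum4_comm]

/-- **The symbol of the exact effective map, matrix–vector form** (`ν > 0`):
`(T_{psiStarᵀ}(k) z)_i = Σ_l [(ν/(4π²)) Σ_{j j'} (êⱼ·k)(ê_{j'}·k) Re((M_{jj'} e_l)_i)] · z_l` — the modal generator of `(c/ν)•Ψ` at the slow mode is the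
period-mean feedback operator `Σ_{jj'} (êⱼ·ℓ)(ê_{j'}·ℓ) Re M_{jj'}`. [cite: MajdaKramer1999, §2.2.1.3 (55)] [cite: Frisch1995Turbulence, §9.6.3 eq. (9.57) p. 233] -/
theorem symbT_majorTranspose_psiStar_apply (W : LatticeWord k₀) (M : ℝ) (hM : 0 < M) {ν : ℝ} (hν : 0 < ν) (S : Torus.Visc4 (Fin 3))
    (k : Fin 3 → ℤ) (z : EuclideanSpace ℂ (Fin 3)) (i : Fin 3) :
    Torus.symbT (Torus.majorTranspose (psiStar W M hM ν S)) k z i =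
      ∑ l, (((ν / (4 * Real.pi ^ 2) : ℝ) : ℂ) * ∑ j : Fin k₀, ∑ j' : Fin k₀,
        ((∑ a, (((W.stretch M hM).stretch (1 / ν) (one_div_pos.mpr hν)).phase j).e a * (k a : ℝ) : ℝ) : ℂ) *
        ((∑ b, (((W.stretch M hM).stretch (1 / ν) (one_div_pos.mpr hν)).phase j').e b * (k b : ℝ) : ℝ) : ℂ) *
        ((((meanFeedback ((W.stretch M hM).stretch (1 / ν) (one_div_pos.mpr hν)) (ν • S) 1 (R0 ν) j j'
          (EuclideanSpace.single l (1:ℂ))) i).re : ℝ) : ℂ)) * z l := by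
  rw [Torus.symbT_apply]
  refine Finset.sum_congr rfl fun l _ => ?_
  rw [← symb_majorTranspose_psiStar_entry W M hM hν S k i l, Finset.sum_mul]
  refine Finset.sum_congr rfl fun a _ => ?_
  rw [Finset.sum_mul]

/-- Off `ν > 0` the symbol of `psiStar` vanishes. [cite: MajdaKramer1999, §2.2.1.3] -/
theorem symbT_majorTranspose_psiStar_of_not_pos (W : LatticeWord k₀) (M : ℝ) (hM : 0 < M) {ν : ℝ} (hν : ¬ 0 < ν) (S : Torus.Visc4 (Fin 3))
    (k : Fin 3 → ℤ) (z : EuclideanSpace ℂ (Fin 3)) : Torus.symbT (Torus.majorTranspose (psiStar W M hM ν S)) k z = 0 := by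
  ext i
  rw [Torus.symbT_apply, psiStar_of_not_pos W M hM hν S]
  simp

end Summit.AnomalousDissipation.AnomalousDissipation.Theorems.SolenoidalFractalHomogenisation.LagrangianStep.Sideband

end
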